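import Literature.Combinatorics.Enumerative.MultivariateAperyNumbers
import HarnessLib

/-!
# Gauss supercongruences for the Osburn–Sahu–Straub family `𝒮(n; A,B,C)` (2016) and Liu's next `p`-adic digit (2024)

Topic `Literature/Combinatorics/Enumerative` (joins `AperyLucasCongruences`, `AperySupercongruences`,
`MultivariateAperyNumbers`). Typed, cited statements read on the page (this session) from
* R. Osburn, B. Sahu, A. Straub, *Supercongruences for sporadic sequences*, Proc. Edinb. Math. Soc. **59** (2016)
  503–518 = arXiv:1312.2195 [OsburnSahuStraub2016] (held text `paper:arxiv-1312.2195`, arXiv numbering);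
* J.-C. Liu, *An extension of Gauss congruences for Apéry numbers*, arXiv:2404.16636 (2024) [Liu2024Gauss] (fetched
  text `paper:arxiv-2404.16636`, pp. 3–4).

## What is printed (verbatim)

[OsburnSahuStraub2016] §1: "(6) `s₇(n) = Σ_{k=0}^{n} C(n,k)² C(n+k,k) C(2k,n)` as well as
(7) `s₁₈(n) = Σ_{k=0}^{[n/3]} (−1)^k C(n,k) C(2k,k) C(2(n−k), n−k) [C(2n−3k−1, n) + C(2n−3k, n)]`, with `s₁₈(0) = 1`."
"For integers `A`, `B`, `C`, let (11) `𝒮(n; A,B,C) = Σ_{k=0}^{n} C(n,k)^A C(n+k,k)^B C(2k,n)^C`. Note that this family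
of sequences includes the Apéry numbers as well as the sequence `s₇(n)`."
**Theorem 1.2.** "Let `A ≥ 2` and `B, C ≥ 0` be integers. For any integers `m, r ≥ 1` and primes `p ≥ 5`, we have
(12) `𝒮(mp^r; A,B,C) ≡ 𝒮(mp^{r−1}; A,B,C) (mod p^{3r})`."
**Theorem 1.3.** "For any integers `m, r ≥ 1` and any primes `p`, we have (13) `s₁₈(mp^r) ≡ s₁₈(mp^{r−1}) (mod p^{2r})`."
(§4, p. 9: Zagier's/AvSZ's cases: "Cases A and D have been proven by Coster", …; special cases of (11) as tabulated
in [Liu2024Gauss] p. 3: `(3,0,0)` Franel, `(2,1,0)` Apéry `ζ(2)` ("D"), `(2,0,2)` "(ε)", `(2,2,0)` Apéry `ζ(3)` ("(γ)"),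
`(2,1,1)` `s₇`, `(4,0,0)` Yang–Zudilin `s₁₀`.)

[Liu2024Gauss] **Theorem 1.1** (p. 4). "Let `p ≥ 5` be a prime, `n, m ∈ ℤ⁺`, and `r, s, t ∈ ℕ` with `r ≥ 2`. Then
`A^{(r,s,t)}_{np^m} ≡ A^{(r,s,t)}_{np^{m−1}} + p^{3m} B_{p−3} 𝒜^{(r,s,t)}_n (mod p^{3m+1})`,
where `𝒜^{(r,s,t)}_n`, independent of `m` and `p`, are given by
`𝒜^{(2,s,t)}_n = −⅓ Σ_{k=0}^{n} C(n,k)² C(n+k,k)^s C(2k,n)^t · nk(sn + sk + 2n − 2k + 4tk − 2tn)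
  + ⅙ Σ_{k=0}^{n−1} C(n,k)² C(n+k,k)^s C(2k,n)^t · (n−k)² (9nt − 3ns + 24k − 18n + 14)
  + ⅙ Σ_{k=0}^{n−1} C(n,k)² C(n+k,k)^s C(2k+1,n)^t · (n−k)² (9ns + 15nt − 24k + 6n − 10)`,
`𝒜^{(3,s,t)}_n = −⅓ Σ_{k=0}^{n} C(n,k)³ C(n+k,k)^s C(2k,n)^t · nk(sn + sk + 3n − 3k + 4tk − 2tn)
  + ¼ Σ_{k=0}^{n−1} (n−k)³ C(n,k)³ C(n+k,k)^s (C(2k,n)^t + C(2k+1,n)^t)`,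
and `𝒜^{(r,s,t)}_n = −⅓ Σ_{k=0}^{n} C(n,k)^r C(n+k,k)^s C(2k,n)^t · nk(sn + sk + rn − rk + 4tk − 2tn)` for `r ≥ 4`."
Here `A^{(r,s,t)}_n = Σ_{k=0}^{n} C(n,k)^r C(n+k,k)^s C(2k,n)^t` (p. 3, = (11) of [OsburnSahuStraub2016]) and `B_n` are the
Bernoulli numbers of `z/(e^z − 1)` (p. 3; `B_{p−3}` has even index, so Mathlib's `bernoulli = bernoulli'` there).

## What is typed / proved

* `ossS A B C n : ℕ` IS (11); PROVED `ossS_zero : 𝒮(n; A,B,0) = AperyLucasCongruences.genApery A B n` (so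
  `(2,2,0)`/`(2,1,0)` are the tree's two Apéry sequences via `genApery_two_two`/`genApery_two_one`); `s7 := 𝒮(·;2,1,1)`,
  `s18` IS (7) (with the printed `s₁₈(0) = 1`); kernel checks of initial values.
* NAMED FACTS: `oss2016_theorem12` ((12)), `oss2016_theorem13` ((13)), `liu2024_theorem11` (Liu's Theorem 1.1, with
  `liuCalA r s t n : ℚ` the printed `𝒜^{(r,s,t)}_n`, stated — as in the tree's `GlaisherHarmonicCongruences` — as the
  bound `v_p(A_{np^m} − A_{np^{m−1}} − p^{3m}B_{p−3}𝒜_n) ≤ exp(−(3m+1))` on `Rat.padicValuation`).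
* PROVED: `oss2016_theorem12_two_zero_one` (the case `A = 2`, `C = 0`, `r = 1` — the tree's
  `AperySupercongruences.genApery_two_modEq_mul_prime`), `coster1988_of_oss2016` ((12) at `(2,2,0)` is Coster's
  supercongruence `MultivariateAperyNumbers.coster1988_supercongruence`).

Transcription checks (this session, exact rational arithmetic outside Lean): Liu's congruence with the three printed
`𝒜`-formulas holds for `(r,s,t) ∈ {(2,2,0),(2,1,0),(2,0,2),(2,1,1),(2,0,0),(2,0,1),(3,0,0),(3,1,0),(3,1,1),(4,0,0),
(4,1,0),(5,0,1)}`, `p ∈ {5,7,11}`, `m ∈ {1,2}` (`p = 5`), `1 ≤ n ≤ 4` (no violation); (13) holds for `p ∈ {2,3,5,7}`,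
`r ∈ {1,2}`, `mp^r < 60`.  REMARK (transcription): the parameter tuple `(14, 6, −192, 12)` printed for `s₁₈` in the
recurrence (8) `(n+1)³s(n+1) = (2n+1)(an²+an+b)s(n) − n(cn²+d)s(n−1)` reproduces (7) (`1, 6, 54, 564, 6390, …`) only
with `(c,d) = (192, −12)`; with the printed signs the recurrence is not even integral at `n = 4`.  We type (7), not (8).
-/

open Finset

namespace Literature.Combinatorics.Enumerative.AperyGaussCongruences

/-! ### The family `𝒮(n; A,B,C)` and the sporadic sequences `s₇`, `s₁₈` -/

/-- `𝒮(n; A,B,C) = Σ_{k=0}^{n} C(n,k)^A C(n+k,k)^B C(2k,n)^C` (= Liu's `A^{(r,s,t)}_n`).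
[cite: OsburnSahuStraub2016, (11)] [cite: Liu2024Gauss, (1.5) (p. 3)] -/
def ossS (A B C n : ℕ) : ℕ :=
  ∑ k ∈ range (n + 1), n.choose k ^ A * (n + k).choose k ^ B * (2 * k).choose n ^ C

/-- `𝒮(n; A,B,0)` is the tree's generalized Apéry number `A_{A,B}(n) = Σ_k C(n,k)^A C(n+k,k)^B`.
[cite: OsburnSahuStraub2016, (11) (with §1: "includes the Apéry numbers")] -/
theorem ossS_zero (A B n : ℕ) : ossS A B 0 n = AperyLucasCongruences.genApery A B n := by
  simp [ossS, AperyLucasCongruences.genApery]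

/-- Cooper's sporadic sequence `s₇(n) = Σ_k C(n,k)² C(n+k,k) C(2k,n) = 𝒮(n; 2,1,1)`.
[cite: OsburnSahuStraub2016, (6) and (11)] -/
def s7 (n : ℕ) : ℕ := ossS 2 1 1 n

/-- Cooper's sporadic sequence `s₁₈(n) = Σ_{k=0}^{[n/3]} (−1)^k C(n,k) C(2k,k) C(2(n−k),n−k) [C(2n−3k−1,n) + C(2n−3k,n)]`
for `n ≥ 1`, `s₁₈(0) = 1`. [cite: OsburnSahuStraub2016, (7)] -/
def s18 (n : ℕ) : ℤ :=
  if n = 0 then 1 else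
    ∑ k ∈ range (n / 3 + 1), (-1 : ℤ) ^ k *
      ((n.choose k * (2 * k).choose k * (2 * (n - k)).choose (n - k) *
        ((2 * n - 3 * k - 1).choose n + (2 * n - 3 * k).choose n) : ℕ) : ℤ)

/-- Kernel check of initial values: Franel `𝒮(·;3,0,0) = 1,2,10,56`, Yang–Zudilin `𝒮(·;4,0,0) = 1,2,18,164`,
`s₇ = 1,4,48,760`, "(ε)" `𝒮(·;2,0,2) = 1,4,40,544`, `s₁₈ = 1,6,54,564` (the last two lists computed from (7) this session).
[cite: Liu2024Gauss, table p. 3] [cite: OsburnSahuStraub2016, (6)–(7)] -/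
theorem values :
    [ossS 3 0 0 1, ossS 3 0 0 2, ossS 3 0 0 3, ossS 4 0 0 2, ossS 4 0 0 3, s7 1, s7 2, s7 3, ossS 2 0 2 2,
      ossS 2 0 2 3] = [2, 10, 56, 18, 164, 4, 48, 760, 40, 544] ∧
    [s18 0, s18 1, s18 2, s18 3] = [1, 6, 54, 564] := by
  constructor <;> decide

/-! ### The Gauss supercongruences (named facts) -/

/-- **Osburn–Sahu–Straub 2016, Theorem 1.2** (named fact): for integers `A ≥ 2`, `B, C ≥ 0`, `m, r ≥ 1` and primes
`p ≥ 5`, `𝒮(mp^r; A,B,C) ≡ 𝒮(mp^{r−1}; A,B,C) (mod p^{3r})`. [cite: OsburnSahuStraub2016, Theorem 1.2 (12)] -/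
def oss2016_theorem12 : Prop :=
  ∀ p : ℕ, p.Prime → 5 ≤ p → ∀ A B C : ℕ, 2 ≤ A → ∀ m r : ℕ, 1 ≤ m → 1 ≤ r →
    (ossS A B C (m * p ^ r) : ℤ) ≡ ossS A B C (m * p ^ (r - 1)) [ZMOD (p : ℤ) ^ (3 * r)]

/-- **Osburn–Sahu–Straub 2016, Theorem 1.3** (named fact): for integers `m, r ≥ 1` and any prime `p`,
`s₁₈(mp^r) ≡ s₁₈(mp^{r−1}) (mod p^{2r})`. [cite: OsburnSahuStraub2016, Theorem 1.3 (13)] -/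
def oss2016_theorem13 : Prop :=
  ∀ p : ℕ, p.Prime → ∀ m r : ℕ, 1 ≤ m → 1 ≤ r → s18 (m * p ^ r) ≡ s18 (m * p ^ (r - 1)) [ZMOD (p : ℤ) ^ (2 * r)]

/-- The case `A = 2`, `C = 0`, `r = 1` of Theorem 1.2, unconditionally (the tree's Gessel/Coster-type theorem
`AperySupercongruences.genApery_two_modEq_mul_prime`): `𝒮(mp; 2,B,0) ≡ 𝒮(m; 2,B,0) (mod p³)` for primes `p ≥ 5`.
[cite: OsburnSahuStraub2016, Theorem 1.2 (r = 1; §4 "Cases A and D have been proven by Coster")] -/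
theorem oss2016_theorem12_two_zero_one (p : ℕ) (hp : p.Prime) (h5 : 5 ≤ p) (B m : ℕ) :
    (ossS 2 B 0 (m * p ^ 1) : ℤ) ≡ ossS 2 B 0 (m * p ^ (1 - 1)) [ZMOD (p : ℤ) ^ (3 * 1)] := by
  rw [ossS_zero, ossS_zero]
  simpa using AperySupercongruences.genApery_two_modEq_mul_prime (p := p) hp (by omega) B m

/-- (12) at `(A,B,C) = (2,2,0)` is Coster's prime-power supercongruence for the Apéry numbers
(`MultivariateAperyNumbers.coster1988_supercongruence`). [cite: OsburnSahuStraub2016, §1 ("generalizes the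
supercongruence (3) for the Apéry numbers")] -/
theorem coster1988_of_oss2016 (h : oss2016_theorem12) : MultivariateAperyNumbers.coster1988_supercongruence := by
  intro p hp h5 r hr m
  rcases Nat.eq_zero_or_pos m with hm | hm
  · subst hm; simp
  have := h p hp h5 2 2 0 le_rfl m r hm hr
  rw [ossS_zero, ossS_zero, AperyLucasCongruences.genApery_two_two, AperyLucasCongruences.genApery_two_two] at this
  simpa [mul_comm] using this

/-! ### Liu 2024: the next `p`-adic digit -/

/-- The summand `C(n,k)^r C(n+k,k)^s C(j,n)^t` as a rational number (`j = 2k` or `2k+1`). [cite: Liu2024Gauss, Theorem 1.1] -/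
def liuTerm (r s t n k j : ℕ) : ℚ := ((n.choose k ^ r * (n + k).choose k ^ s * j.choose n ^ t : ℕ) : ℚ)

/-- Liu's `𝒜^{(r,s,t)}_n ∈ ℚ`, by the three printed formulas (`r = 2`, `r = 3`, `r ≥ 4`; for `r ≤ 1` we use the last
formula, outside the theorem's scope). [cite: Liu2024Gauss, Theorem 1.1 (the displayed formulas for 𝒜)] -/
def liuCalA (r s t n : ℕ) : ℚ :=
  if r = 2 then
    -(1 / 3 : ℚ) * ∑ k ∈ range (n + 1), liuTerm 2 s t n k (2 * k) *
        ((n : ℚ) * k * ((s : ℚ) * n + (s : ℚ) * k + 2 * n - 2 * k + 4 * (t : ℚ) * k - 2 * (t : ℚ) * n))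
      + (1 / 6 : ℚ) * ∑ k ∈ range n, liuTerm 2 s t n k (2 * k) *
        (((n : ℚ) - k) ^ 2 * (9 * (n : ℚ) * t - 3 * (n : ℚ) * s + 24 * k - 18 * n + 14))
      + (1 / 6 : ℚ) * ∑ k ∈ range n, liuTerm 2 s t n k (2 * k + 1) *
        (((n : ℚ) - k) ^ 2 * (9 * (n : ℚ) * s + 15 * (n : ℚ) * t - 24 * k + 6 * n - 10))
  else if r = 3 then
    -(1 / 3 : ℚ) * ∑ k ∈ range (n + 1), liuTerm 3 s t n k (2 * k) *
        ((n : ℚ) * k * ((s : ℚ) * n + (s : ℚ) * k + 3 * n - 3 * k + 4 * (t : ℚ) * k - 2 * (t : ℚ) * n))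
      + (1 / 4 : ℚ) * ∑ k ∈ range n, ((n : ℚ) - k) ^ 3 * (liuTerm 3 s t n k (2 * k) + liuTerm 3 s t n k (2 * k + 1))
  else
    -(1 / 3 : ℚ) * ∑ k ∈ range (n + 1), liuTerm r s t n k (2 * k) *
        ((n : ℚ) * k * ((s : ℚ) * n + (s : ℚ) * k + (r : ℚ) * n - (r : ℚ) * k + 4 * (t : ℚ) * k - 2 * (t : ℚ) * n))

/-- Kernel check: `𝒜^{(2,2,0)}_1 = −14/3` (computed this session from the printed formula; the congruence
`A_{p} ≡ A_1 − (14/3)p³B_{p−3} (mod p⁴)` was checked exactly for `p = 5, 7, 11`). [cite: Liu2024Gauss, Theorem 1.1] -/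
theorem liuCalA_two_two_zero_one : liuCalA 2 2 0 1 = -14 / 3 := by
  norm_num [liuCalA, liuTerm, Finset.sum_range_succ]

/-- **Liu 2024, Theorem 1.1** (named fact): for primes `p ≥ 5`, `n, m ≥ 1`, `r ≥ 2`, `s, t ≥ 0`,
`A^{(r,s,t)}_{np^m} ≡ A^{(r,s,t)}_{np^{m−1}} + p^{3m} B_{p−3} 𝒜^{(r,s,t)}_n (mod p^{3m+1})`, i.e.
`v_p(A_{np^m} − A_{np^{m−1}} − p^{3m}B_{p−3}𝒜_n) ≤ exp(−(3m+1))`. [cite: Liu2024Gauss, Theorem 1.1] -/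
def liu2024_theorem11 : Prop :=
  ∀ (p : ℕ) [Fact p.Prime], 5 ≤ p → ∀ n m : ℕ, 1 ≤ n → 1 ≤ m → ∀ r s t : ℕ, 2 ≤ r →
    Rat.padicValuation p ((ossS r s t (n * p ^ m) : ℚ) - (ossS r s t (n * p ^ (m - 1)) : ℚ) -
        (p : ℚ) ^ (3 * m) * bernoulli (p - 3) * liuCalA r s t n) ≤ WithZero.exp (-(3 * (m : ℤ) + 1))

end Literature.Combinatorics.Enumerative.AperyGaussCongruences
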